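import Summits.CriticalPhenomena.PercolationContinuityZ3.Theorems.PercNearOneGluingAdditiveGluingTwoStepGlueV3pp
import Summits.CriticalPhenomena.PercolationContinuityZ3.Theorems.PercNearOneGluingAdditiveGluingGluePushforward
import Summits.CriticalPhenomena.PercolationContinuityZ3.Theorems.PercNearOneGluingAdditiveGluingGlueReach
import HarnessLib

/-!
# Crux `PercNearOneGluing.AdditiveGluing` (stmt-CriticalPhenomena-4576): the half Theorem 1 of a glued SET, pulled back (`setGlue_half`)

Support file (`--supports stmt-CriticalPhenomena-4576`; lead-of-record prim-png-lead-4576, gen 2).  No definitions, no named facts,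
no sorries.  Discharges the hypothesis `hHalf` of `additiveGluing_of_half_k0set2` (…Theorems/PercNearOneGluingAdditiveGluingSetGlueK0.lean,
p184093): with it, `additiveGluing_of_half_k0set2 setGlue_half` is the implication **(K₀-set)_{|S| ≥ 2} ⟹ `AdditiveGluing`**
(ONE kernel family for every number of relays; its `|S| = 2` member is the registered `stub_k0_dp`, its `|S| ≥ 3` members the
registered `stub_k0set3_g2`).  This file deliberately imports only long-built modules (the pull-back lemmas `setGlue_pull_*` of
`…SetGluePullback.lean`, p183711, are re-derived inside the proof as local facts) so that it can be checked during the gate build backlog;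
the one-line corollaries are recorded in `…SetGlueK0Closed.lean` once both modules are built.

Content: glue the finite set `S` (weight `1` on every non-loop pair inside `S`; the glued law is the image of `μ = prodBernoulli w` under
`ω ↦ ω ∪ D_S`, landed `stub_gluePushforward`; reachability in `ω ∪ D_S` is reachability in `ω` possibly through `S`, landed
`stub_glueReach`), apply the one-sided weighted Kozma–Nitzan Theorem 1 `twoStep_thm1_half` to the relays `(c, s₀)` (`s₀ ∈ S`, `c ∉ S`)
of the glued weighting, and pull the six events back: `{c↮s₀}* = CSᶜ` (`CS = ⋃_{s∈S} c↔s`), `{o↔b}* = o↔b ∪ (OS ∩ BS)`,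
`{s₀↔b}* = BS`, `{o↔c ∪ o↔s₀}* = o↔c ∪ OS`, `{c↔b}* ∩ CSᶜ = c↔b ∩ CSᶜ`, `{o↔c}* ∩ CSᶜ = o↔c ∩ CSᶜ`.
[cite: KozmaNitzan2024, Theorem 1 / (6) (pp. 7–8), §3.1 Remark after Lemma 4 (gluing = probability 1), §5.3 (p. 34)]
[cite: VandenbergHaggstromKahn2005, Thms. 1.3–1.4]
-/

namespace Summit.CriticalPhenomena.PercolationContinuityZ3.Theorems

open MeasureTheory Set Literature.Probability.LatticeModels Literature.Probability.Percolation

noncomputable section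
open Classical

variable {n : ℕ}

/-- **The pulled-back half Theorem 1 of a glued set** (= hypothesis `hHalf` of `additiveGluing_of_half_k0set2`): for `S` nonempty and
`c ∉ S`, `μ(CSᶜ ∩ o↔c)·(μ(CSᶜ ∩ c↔b) − μ(CSᶜ ∩ BS)) ≤ μ(CSᶜ)·(μ((o↔b ∪ OS∩BS) ∩ (o↔c ∪ OS)) − μ((o↔c ∪ OS) ∩ BS))`.
[cite: KozmaNitzan2024, Theorem 1 / (6) (pp. 7–8)] [cite: VandenbergHaggstromKahn2005, Thms. 1.3–1.4] -/
theorem setGlue_half : ∀ (n : ℕ) (w : Sym2 (Fin n) → unitInterval) (S : Finset (Fin n)) (o b c : Fin n), S.Nonempty → c ∉ S →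
      (prodBernoulli w).real ((⋃ s ∈ S, (openConn c s : Set (BondConfig (Fin n))))ᶜ ∩ openConn o c) *
          ((prodBernoulli w).real ((⋃ s ∈ S, (openConn c s : Set (BondConfig (Fin n))))ᶜ ∩ openConn c b) -
            (prodBernoulli w).real ((⋃ s ∈ S, (openConn c s : Set (BondConfig (Fin n))))ᶜ ∩
              (⋃ s ∈ S, (openConn s b : Set (BondConfig (Fin n)))))) ≤
        (prodBernoulli w).real ((⋃ s ∈ S, (openConn c s : Set (BondConfig (Fin n))))ᶜ) *
          ((prodBernoulli w).real
              ((openConn o b ∪ ((⋃ s ∈ S, (openConn o s : Set (BondConfig (Fin n)))) ∩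
                  (⋃ s ∈ S, (openConn s b : Set (BondConfig (Fin n)))))) ∩
                (openConn o c ∪ ⋃ s ∈ S, (openConn o s : Set (BondConfig (Fin n))))) -
            (prodBernoulli w).real ((openConn o c ∪ ⋃ s ∈ S, (openConn o s : Set (BondConfig (Fin n)))) ∩
              (⋃ s ∈ S, (openConn s b : Set (BondConfig (Fin n)))))) := by
  intro n w S o b c hS hc
  obtain ⟨s₀, hs₀⟩ := hS
  have hcs : c ≠ s₀ := fun h => hc (h ▸ hs₀)
  have hr : ∀ ω : BondConfig (Fin n), ω ∈ (openConn s₀ s₀ : Set (BondConfig (Fin n))) := fun ω => fullTie_mem_openConn_self s₀ ω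
  -- reachability after gluing `S`: `x ↔* s₀ ⟺ x ↔ S`, `s₀ ↔* y ⟺ S ↔ y`
  have hR : ∀ (ω : BondConfig (Fin n)) (x : Fin n),
      (ω ∪ {e | (∀ z ∈ e, z ∈ S) ∧ ¬ e.IsDiag}) ∈ (openConn x s₀ : Set (BondConfig (Fin n))) ↔
        ∃ s ∈ S, ω ∈ (openConn x s : Set (BondConfig (Fin n))) := by
    intro ω x
    rw [stub_glueReach]
    constructor
    · rintro (h | ⟨h, _⟩)
      · exact ⟨s₀, hs₀, h⟩
      · exact h
    · exact fun h => Or.inr ⟨h, ⟨s₀, hs₀, hr ω⟩⟩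
  have hL : ∀ (ω : BondConfig (Fin n)) (y : Fin n),
      (ω ∪ {e | (∀ z ∈ e, z ∈ S) ∧ ¬ e.IsDiag}) ∈ (openConn s₀ y : Set (BondConfig (Fin n))) ↔
        ∃ s ∈ S, ω ∈ (openConn s y : Set (BondConfig (Fin n))) := by
    intro ω y
    rw [stub_glueReach]
    constructor
    · rintro (h | ⟨_, h⟩)
      · exact ⟨s₀, hs₀, h⟩
      · exact h
    · exact fun h => Or.inr ⟨⟨s₀, hs₀, hr ω⟩, h⟩
  -- the six pull-backs
  have P1 : (prodBernoulli (fun e : Sym2 (Fin n) => if (∀ x ∈ e, x ∈ S) ∧ ¬ e.IsDiag then 1 else w e)).real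
        ((openConn c s₀)ᶜ ∩ openConn o c : Set (BondConfig (Fin n))) =
      (prodBernoulli w).real ((⋃ s ∈ S, (openConn c s : Set (BondConfig (Fin n))))ᶜ ∩ openConn o c) := by
    rw [stub_gluePushforward]
    congr 1
    ext ω
    simp only [Set.mem_setOf_eq, Set.mem_inter_iff, Set.mem_compl_iff, Set.mem_iUnion, exists_prop, hR, stub_glueReach]
    constructor
    · rintro ⟨hD, hO⟩
      refine ⟨fun ⟨s, hs, h⟩ => hD ⟨s, hs, h⟩, ?_⟩
      rcases hO with h | ⟨_, ⟨s, hs, h⟩⟩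
      · exact h
      · exact absurd ⟨s, hs, SimpleGraph.Reachable.symm h⟩ hD
    · rintro ⟨hD, hO⟩
      exact ⟨fun ⟨s, hs, h⟩ => hD ⟨s, hs, h⟩, Or.inl hO⟩
  have P2 : (prodBernoulli (fun e : Sym2 (Fin n) => if (∀ x ∈ e, x ∈ S) ∧ ¬ e.IsDiag then 1 else w e)).real
        ((openConn c s₀)ᶜ ∩ openConn c b : Set (BondConfig (Fin n))) =
      (prodBernoulli w).real ((⋃ s ∈ S, (openConn c s : Set (BondConfig (Fin n))))ᶜ ∩ openConn c b) := by
    rw [stub_gluePushforward]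
    congr 1
    ext ω
    simp only [Set.mem_setOf_eq, Set.mem_inter_iff, Set.mem_compl_iff, Set.mem_iUnion, exists_prop, hR, stub_glueReach]
    constructor
    · rintro ⟨hD, hB⟩
      refine ⟨fun ⟨s, hs, h⟩ => hD ⟨s, hs, h⟩, ?_⟩
      rcases hB with h | ⟨⟨s, hs, h⟩, _⟩
      · exact h
      · exact absurd ⟨s, hs, h⟩ hD
    · rintro ⟨hD, hB⟩
      exact ⟨fun ⟨s, hs, h⟩ => hD ⟨s, hs, h⟩, Or.inl hB⟩
  have P3 : (prodBernoulli (fun e : Sym2 (Fin n) => if (∀ x ∈ e, x ∈ S) ∧ ¬ e.IsDiag then 1 else w e)).real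
        ((openConn c s₀)ᶜ ∩ openConn s₀ b : Set (BondConfig (Fin n))) =
      (prodBernoulli w).real ((⋃ s ∈ S, (openConn c s : Set (BondConfig (Fin n))))ᶜ ∩
        (⋃ s ∈ S, (openConn s b : Set (BondConfig (Fin n))))) := by
    rw [stub_gluePushforward]
    congr 1
    ext ω
    simp only [Set.mem_setOf_eq, Set.mem_inter_iff, Set.mem_compl_iff, Set.mem_iUnion, exists_prop, hR, hL]
  have P4 : (prodBernoulli (fun e : Sym2 (Fin n) => if (∀ x ∈ e, x ∈ S) ∧ ¬ e.IsDiag then 1 else w e)).real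
        ((openConn c s₀)ᶜ : Set (BondConfig (Fin n))) =
      (prodBernoulli w).real ((⋃ s ∈ S, (openConn c s : Set (BondConfig (Fin n))))ᶜ) := by
    rw [stub_gluePushforward]
    congr 1
    ext ω
    simp only [Set.mem_setOf_eq, Set.mem_compl_iff, Set.mem_iUnion, exists_prop, hR]
  have P5 : (prodBernoulli (fun e : Sym2 (Fin n) => if (∀ x ∈ e, x ∈ S) ∧ ¬ e.IsDiag then 1 else w e)).real
        (openConn o b ∩ (openConn o c ∪ openConn o s₀) : Set (BondConfig (Fin n))) =
      (prodBernoulli w).real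
        ((openConn o b ∪ ((⋃ s ∈ S, (openConn o s : Set (BondConfig (Fin n)))) ∩
            (⋃ s ∈ S, (openConn s b : Set (BondConfig (Fin n)))))) ∩
          (openConn o c ∪ ⋃ s ∈ S, (openConn o s : Set (BondConfig (Fin n))))) := by
    rw [stub_gluePushforward]
    congr 1
    ext ω
    simp only [Set.mem_setOf_eq, Set.mem_inter_iff, Set.mem_union, Set.mem_iUnion, exists_prop, hR, stub_glueReach]
    constructor
    · rintro ⟨hB, hO⟩
      refine ⟨hB, ?_⟩
      rcases hO with (h | ⟨h, _⟩) | h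
      · exact Or.inl h
      · exact Or.inr h
      · exact Or.inr h
    · rintro ⟨hB, hO⟩
      refine ⟨hB, ?_⟩
      rcases hO with h | h
      · exact Or.inl (Or.inl h)
      · exact Or.inr h
  have P6 : (prodBernoulli (fun e : Sym2 (Fin n) => if (∀ x ∈ e, x ∈ S) ∧ ¬ e.IsDiag then 1 else w e)).real
        ((openConn o c ∪ openConn o s₀) ∩ openConn s₀ b : Set (BondConfig (Fin n))) =
      (prodBernoulli w).real
        ((openConn o c ∪ ⋃ s ∈ S, (openConn o s : Set (BondConfig (Fin n)))) ∩
          (⋃ s ∈ S, (openConn s b : Set (BondConfig (Fin n))))) := by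
    rw [stub_gluePushforward]
    congr 1
    ext ω
    simp only [Set.mem_setOf_eq, Set.mem_inter_iff, Set.mem_union, Set.mem_iUnion, exists_prop, hR, hL, stub_glueReach]
    constructor
    · rintro ⟨hO, hB⟩
      refine ⟨?_, hB⟩
      rcases hO with (h | ⟨h, _⟩) | h
      · exact Or.inl h
      · exact Or.inr h
      · exact Or.inr h
    · rintro ⟨hO, hB⟩
      refine ⟨?_, hB⟩
      rcases hO with h | h
      · exact Or.inl (Or.inl h)
      · exact Or.inr h
  have hH := twoStep_thm1_half (fun e : Sym2 (Fin n) => if (∀ x ∈ e, x ∈ S) ∧ ¬ e.IsDiag then 1 else w e) o b c s₀ hcs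
  rw [P1, P2, P3, P4, P5, P6] at hH
  exact hH

end

end Summit.CriticalPhenomena.PercolationContinuityZ3.Theorems
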